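import Summits.BirchSwinnertonDyer.BirchSwinnertonDyer.Theorems.CyclotomicUntwistCompanionShapeLaw
import Literature.NumberTheory.EllipticCurves.QuadraticTwist
import HarnessLib

/-!
# The V10 shapes are MODEL-invariant, and the `χ₋₃`-twist swaps ORD1 ↔ ET1, ORDM ↔ ETM
# (route `CyclotomicUntwist` seat `bsd-line-cycu-p2` g5, O6 lane V10; THEOREMS ONLY)

`Additive/WildThreeResidualShape.lean` records as EVIDENCE ("checked on 4 996 located twist partners")
that the `−3` twist swaps `ORD1 ↔ ET1`, `ORDM ↔ ETM` and fixes `IRR`, `SPLIT`. Kernel form: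

* §1 `shapes_smul_iff` — for EVERY change of variables `C` (any `u ≠ 0`, `r, s, t`) all six shapes of
  `C • W` and `W` agree: `Ψ₃^{C•W}(x) = u⁻⁸ Ψ₃^W(u²x + r)`, `Ψ₂²^{C•W}(x) = u⁻⁶ Ψ₂²^W(u²x + r)` and
  `u⁻⁶ = (u⁻³)²` is a square (`sq_mul_shape_invariant`); so the shapes of a curve may be read on ANY
  model (the census reads minimal models);
* §2 `stableLineSignThree_quadraticTwist` — for the tree's model `W.quadraticTwist d`
  (`Literature/…/QuadraticTwist.lean`): `Ψ₃^{W^d}(dx) = d⁴Ψ₃^W(x)`, `Ψ₂²^{W^d}(dx) = d³Ψ₂²^W(x)` — the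
  line character is multiplied by the quadratic character of `ℚ₃(√d)`;
* §3 `d = −3` (`d³ = 3²·(−3)`: parity of `v₃` flips, unit part changes sign):
  **`shapeORD1Three_iff_shapeET1Three_twist`**, **`shapeORDMThree_iff_shapeETMThree_twist`**,
  `shapeET1Three_iff_shapeORD1Three_twist`, `shapeETMThree_iff_shapeORDMThree_twist`,
  `shapeIrrThree_twist_iff`, `shapeSplitThree_twist_iff`, `shapeOrdSideThree_iff_shapeEtSideThree_twist`.

With §1 the statements transfer to any model of the twist (e.g. cycu-p4's minimal twists
`exists_minimal_twist_pm_three`). HONEST FRAMING: helper theorems; nothing about any particular curve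
is asserted; BSD is not proved for any curve. References: [Serre1972] §1.11; [SilvermanAEC2009] III.1,
X.2, Ex. 3.7.
-/

set_option linter.dupNamespace false

noncomputable section

open scoped Classical

namespace Summit.BirchSwinnertonDyer.BirchSwinnertonDyer.Theorems.CompanionShape

open Polynomial WeierstrassCurve Literature.NumberTheory.EllipticCurves
  Summit.BirchSwinnertonDyer.Rank1Residual.Additive Summit.BirchSwinnertonDyer.Rank1Residual

/-! ## §0 Two `3`-adic scalings -/

/-- `v₃(−3t) = 1 + v₃(t)` and the unit part of `−3t` is MINUS that of `t`:
`UnitPartCongThree (−3t) ε ↔ UnitPartCongThree t (−ε)`. [folklore] -/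
theorem neg_three_mul_shape {t : ℚ_[3]} (ht : t ≠ 0) (ε : ℚ_[3]) :
    (-3 * t).valuation = 1 + t.valuation ∧
      (UnitPartCongThree (-3 * t) ε ↔ UnitPartCongThree t (-ε)) := by
  have h3 : (-3 : ℚ_[3]) ≠ 0 := by norm_num
  have hv3 : (-3 : ℚ_[3]).valuation = 1 := by
    have h1 : (-1 : ℚ_[3]).valuation = 0 :=
      Literature.NumberTheory.NumberFields.valuation_eq_zero_of_norm_eq_one (by rw [norm_neg, norm_one])
    have h3' : (3 : ℚ_[3]).valuation = 1 := by simp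
    rw [show (-3 : ℚ_[3]) = 3 * (-1) by norm_num, Padic.valuation_mul (by norm_num) (by norm_num), h3', h1,
      add_zero]
  refine ⟨by rw [Padic.valuation_mul h3 ht, hv3], ?_⟩
  have hup : unitPartThree (-3) = -1 := by
    unfold unitPartThree
    rw [hv3, zpow_neg, zpow_one]
    push_cast
    norm_num
  unfold UnitPartCongThree
  rw [unitPartThree_mul h3 ht, hup, neg_one_mul, ← norm_neg, neg_sub, sub_neg_eq_add, add_comm,
    ← sub_neg_eq_add]

/-! ## §1 Model invariance of the six shapes -/

section Model

variable (W : WeierstrassCurve ℚ) (C : VariableChange ℚ)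

/-- The unit `u` of a change of variables is non-zero in `ℚ₃`. [folklore] -/
theorem cast_u_ne_zero : ((C.u : ℚ) : ℚ_[3]) ≠ 0 := by exact_mod_cast C.u.ne_zero

/-- `Ψ₃^{C•W}(x) = u⁻⁸ · Ψ₃^W(u²x + r)` over `ℚ₃`. [cite: SilvermanAEC2009, III.1 and Exercise 3.7] -/
theorem eval_Ψ₃_baseChange_smul (x : ℚ_[3]) :
    (((C • W).baseChange ℚ_[3]).Ψ₃).eval x =
      ((C.u : ℚ)⁻¹ : ℚ_[3]) ^ 8 * ((W.baseChange ℚ_[3]).Ψ₃).eval (((C.u : ℚ) : ℚ_[3]) ^ 2 * x + (C.r : ℚ_[3])) := by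
  have hu := cast_u_ne_zero C
  simp only [WeierstrassCurve.baseChange, Ψ₃, map_b₂, map_b₄, map_b₆, map_b₈, variableChange_b₂,
    variableChange_b₄, variableChange_b₆, variableChange_b₈, eq_ratCast, eval_add, eval_mul, eval_pow,
    eval_C, eval_X, eval_ofNat]
  push_cast
  field_simp
  ring

/-- `Ψ₂²^{C•W}(x) = u⁻⁶ · Ψ₂²^W(u²x + r)` over `ℚ₃`. [cite: SilvermanAEC2009, III.1 and Exercise 3.7] -/
theorem eval_Ψ₂Sq_baseChange_smul (x : ℚ_[3]) :
    (((C • W).baseChange ℚ_[3]).Ψ₂Sq).eval x =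
      ((C.u : ℚ)⁻¹ : ℚ_[3]) ^ 6 *
        ((W.baseChange ℚ_[3]).Ψ₂Sq).eval (((C.u : ℚ) : ℚ_[3]) ^ 2 * x + (C.r : ℚ_[3])) := by
  have hu := cast_u_ne_zero C
  simp only [WeierstrassCurve.baseChange, Ψ₂Sq, map_b₂, map_b₄, map_b₆, variableChange_b₂,
    variableChange_b₄, variableChange_b₆, eq_ratCast, eval_add, eval_mul, eval_pow, eval_C, eval_X]
  push_cast
  field_simp
  ring

/-- Roots correspond: `x` is a root of `Ψ₃^{C•W}` iff `u²x + r` is a root of `Ψ₃^W`. [folklore] -/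
theorem isRoot_Ψ₃_smul_iff (x : ℚ_[3]) :
    (((C • W).baseChange ℚ_[3]).Ψ₃).IsRoot x ↔
      ((W.baseChange ℚ_[3]).Ψ₃).IsRoot (((C.u : ℚ) : ℚ_[3]) ^ 2 * x + (C.r : ℚ_[3])) := by
  rw [IsRoot.def, IsRoot.def, eval_Ψ₃_baseChange_smul, mul_eq_zero, or_iff_right]
  exact pow_ne_zero 8 (inv_ne_zero (cast_u_ne_zero C))

/-- Unique stable lines correspond under any change of variables. [folklore] -/
theorem isUniqueStableLineThree_smul_iff (x₀ : ℚ_[3]) :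
    IsUniqueStableLineThree (C • W) x₀ ↔
      IsUniqueStableLineThree W (((C.u : ℚ) : ℚ_[3]) ^ 2 * x₀ + (C.r : ℚ_[3])) := by
  have hu2 : ((C.u : ℚ) : ℚ_[3]) ^ 2 ≠ 0 := pow_ne_zero 2 (cast_u_ne_zero C)
  set u2 := ((C.u : ℚ) : ℚ_[3]) ^ 2
  set ρ := (C.r : ℚ_[3])
  unfold IsUniqueStableLineThree
  simp only [isRoot_Ψ₃_smul_iff]
  constructor
  · rintro ⟨h0, huniq⟩
    refine ⟨h0, fun r hr ↦ ?_⟩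
    have := huniq (u2⁻¹ * (r - ρ)) (by rwa [← mul_assoc, mul_inv_cancel₀ hu2, one_mul, sub_add_cancel])
    rw [← this, ← mul_assoc, mul_inv_cancel₀ hu2, one_mul, sub_add_cancel]
  · rintro ⟨h0, huniq⟩
    refine ⟨h0, fun r hr ↦ ?_⟩
    have := huniq _ hr
    have h' : u2 * r = u2 * x₀ := by linear_combination this
    exact mul_left_cancel₀ hu2 h'

/-- The sign scales by the square `u⁻⁶`: `F^{C•W}(x₀) = (u⁻³)² · F^W(u²x₀ + r)`. [folklore] -/
theorem stableLineSignThree_smul (x₀ : ℚ_[3]) :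
    stableLineSignThree (C • W) x₀ =
      (((C.u : ℚ)⁻¹ : ℚ_[3]) ^ 3) ^ 2 *
        stableLineSignThree W (((C.u : ℚ) : ℚ_[3]) ^ 2 * x₀ + (C.r : ℚ_[3])) := by
  unfold stableLineSignThree
  rw [eval_Ψ₂Sq_baseChange_smul, ← pow_mul]

/-- **The six V10 shapes are model-invariant**: for every change of variables `C`, each of IRR,
SPLIT, ET1, ETM, ORD1, ORDM holds for `C • W` iff it holds for `W`. [cite: Serre1972, §1.11] -/
theorem shapes_smul_iff :
    (ShapeIrrThree (C • W) ↔ ShapeIrrThree W) ∧ (ShapeSplitThree (C • W) ↔ ShapeSplitThree W) ∧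
      (ShapeET1Three (C • W) ↔ ShapeET1Three W) ∧ (ShapeETMThree (C • W) ↔ ShapeETMThree W) ∧
      (ShapeORD1Three (C • W) ↔ ShapeORD1Three W) ∧ (ShapeORDMThree (C • W) ↔ ShapeORDMThree W) := by
  have hu := cast_u_ne_zero C
  have hu2 : ((C.u : ℚ) : ℚ_[3]) ^ 2 ≠ 0 := pow_ne_zero 2 hu
  have hc : (((C.u : ℚ)⁻¹ : ℚ_[3]) ^ 3) ≠ 0 := pow_ne_zero 3 (inv_ne_zero hu)
  set u2 := ((C.u : ℚ) : ℚ_[3]) ^ 2 with hu2def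
  set ρ := (C.r : ℚ_[3]) with hρ
  -- the affine bijection `x ↦ u²x + r` of `ℚ₃` and its inverse
  have surj : ∀ y : ℚ_[3], u2 * (u2⁻¹ * (y - ρ)) + ρ = y := fun y ↦ by
    rw [← mul_assoc, mul_inv_cancel₀ hu2, one_mul, sub_add_cancel]
  -- one-line shapes: transport of (unique line, sign ≠ 0, parity, unit class)
  have key : ∀ (P : ℤ → Prop) (ε : ℚ_[3]), (∀ v w : ℤ, (∃ c : ℤ, v = 2 * c + w) → (P v ↔ P w)) →
      ((∃ x₀, IsUniqueStableLineThree (C • W) x₀ ∧ stableLineSignThree (C • W) x₀ ≠ 0 ∧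
          P (stableLineSignThree (C • W) x₀).valuation ∧
          UnitPartCongThree (stableLineSignThree (C • W) x₀) ε) ↔
        (∃ x₀, IsUniqueStableLineThree W x₀ ∧ stableLineSignThree W x₀ ≠ 0 ∧
          P (stableLineSignThree W x₀).valuation ∧ UnitPartCongThree (stableLineSignThree W x₀) ε)) := by
    intro P ε hP
    constructor
    · rintro ⟨x₀, hx, hs, hv, hε⟩
      have hx' := (isUniqueStableLineThree_smul_iff W C x₀).mp hx
      have hsW : stableLineSignThree W (u2 * x₀ + ρ) ≠ 0 := by
        intro h0; apply hs; rw [stableLineSignThree_smul, h0, mul_zero]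
      obtain ⟨hval, hunit⟩ := sq_mul_shape_invariant hc hsW
      refine ⟨u2 * x₀ + ρ, hx', hsW, ?_, ?_⟩
      · rw [stableLineSignThree_smul, hval] at hv
        exact (hP _ _ ⟨_, rfl⟩).mp hv
      · rw [stableLineSignThree_smul, hunit] at hε
        exact hε
    · rintro ⟨y₀, hy, hs, hv, hε⟩
      set x₀ := u2⁻¹ * (y₀ - ρ) with hx₀
      have hyx : u2 * x₀ + ρ = y₀ := surj y₀
      have hx : IsUniqueStableLineThree (C • W) x₀ := by
        rw [isUniqueStableLineThree_smul_iff, hyx]; exact hy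
      obtain ⟨hval, hunit⟩ := sq_mul_shape_invariant hc hs
      refine ⟨x₀, hx, ?_, ?_, ?_⟩
      · rw [stableLineSignThree_smul, hyx]; exact mul_ne_zero (pow_ne_zero 2 hc) hs
      · rw [stableLineSignThree_smul, hyx, hval]; exact (hP _ _ ⟨_, rfl⟩).mpr hv
      · rw [stableLineSignThree_smul, hyx, hunit]; exact hε
  have hEven : ∀ v w : ℤ, (∃ c : ℤ, v = 2 * c + w) → (Even v ↔ Even w) := by
    rintro v w ⟨c, rfl⟩
    exact ⟨fun ⟨k, hk⟩ ↦ ⟨k - c, by omega⟩, fun ⟨k, hk⟩ ↦ ⟨k + c, by omega⟩⟩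
  have hOdd : ∀ v w : ℤ, (∃ c : ℤ, v = 2 * c + w) → (Odd v ↔ Odd w) := by
    rintro v w ⟨c, rfl⟩
    exact ⟨fun ⟨k, hk⟩ ↦ ⟨k - c, by omega⟩, fun ⟨k, hk⟩ ↦ ⟨k + c, by omega⟩⟩
  refine ⟨?_, ?_, key Even 1 hEven, key Even (-1) hEven, key Odd (-1) hOdd, key Odd 1 hOdd⟩
  · -- IRR
    constructor
    · intro h y hy
      exact h (u2⁻¹ * (y - ρ)) ((isRoot_Ψ₃_smul_iff W C _).mpr (by rw [surj]; exact hy))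
    · intro h x hx
      exact h _ ((isRoot_Ψ₃_smul_iff W C x).mp hx)
  · -- SPLIT
    constructor
    · rintro ⟨a, b, hab, ha, hb⟩
      refine ⟨u2 * a + ρ, u2 * b + ρ, fun h ↦ hab ?_, (isRoot_Ψ₃_smul_iff W C a).mp ha,
        (isRoot_Ψ₃_smul_iff W C b).mp hb⟩
      exact mul_left_cancel₀ hu2 (by linear_combination h)
    · rintro ⟨a, b, hab, ha, hb⟩
      refine ⟨u2⁻¹ * (a - ρ), u2⁻¹ * (b - ρ), fun h ↦ hab ?_,
        (isRoot_Ψ₃_smul_iff W C _).mpr (by rw [surj]; exact ha),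
        (isRoot_Ψ₃_smul_iff W C _).mpr (by rw [surj]; exact hb)⟩
      have := congrArg (fun z ↦ u2 * z + ρ) h
      simpa only [surj] using this

end Model

/-! ## §2 The quadratic twist scales the sign by `d³` -/

section Twist

variable (W : WeierstrassCurve ℚ) (d : ℚ)

/-- `Ψ₃^{W^d}(dx) = d⁴ Ψ₃^W(x)` over `ℚ₃` (the `b`'s of `W^d` are `d b₂, d² b₄, d³ b₆, d⁴ b₈`).
[cite: SilvermanAEC2009, X.2 and Exercise 3.7] -/
theorem eval_Ψ₃_baseChange_quadraticTwist (x : ℚ_[3]) :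
    (((W.quadraticTwist d).baseChange ℚ_[3]).Ψ₃).eval ((d : ℚ_[3]) * x) =
      (d : ℚ_[3]) ^ 4 * ((W.baseChange ℚ_[3]).Ψ₃).eval x := by
  simp only [WeierstrassCurve.baseChange, Ψ₃, map_b₂, map_b₄, map_b₆, map_b₈, quadraticTwist_b₂,
    quadraticTwist_b₄, quadraticTwist_b₆, quadraticTwist_b₈, eq_ratCast, eval_add, eval_mul, eval_pow,
    eval_C, eval_X, eval_ofNat]
  push_cast
  ring

/-- `Ψ₂²^{W^d}(dx) = d³ Ψ₂²^W(x)` over `ℚ₃`. [cite: SilvermanAEC2009, X.2 and Exercise 3.7] -/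
theorem eval_Ψ₂Sq_baseChange_quadraticTwist (x : ℚ_[3]) :
    (((W.quadraticTwist d).baseChange ℚ_[3]).Ψ₂Sq).eval ((d : ℚ_[3]) * x) =
      (d : ℚ_[3]) ^ 3 * ((W.baseChange ℚ_[3]).Ψ₂Sq).eval x := by
  simp only [WeierstrassCurve.baseChange, Ψ₂Sq, map_b₂, map_b₄, map_b₆, quadraticTwist_b₂,
    quadraticTwist_b₄, quadraticTwist_b₆, eq_ratCast, eval_add, eval_mul, eval_pow, eval_C, eval_X]
  push_cast
  ring

variable {d}

/-- Roots correspond under `x ↦ dx` (`d ≠ 0`). [folklore] -/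
theorem isRoot_Ψ₃_quadraticTwist_iff (hd : d ≠ 0) (x : ℚ_[3]) :
    (((W.quadraticTwist d).baseChange ℚ_[3]).Ψ₃).IsRoot ((d : ℚ_[3]) * x) ↔
      ((W.baseChange ℚ_[3]).Ψ₃).IsRoot x := by
  have hd' : (d : ℚ_[3]) ≠ 0 := by exact_mod_cast hd
  rw [IsRoot.def, IsRoot.def, eval_Ψ₃_baseChange_quadraticTwist, mul_eq_zero, or_iff_right]
  exact pow_ne_zero 4 hd'

/-- Unique stable lines correspond: `dx₀` for `W^d` iff `x₀` for `W`. [folklore] -/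
theorem isUniqueStableLineThree_quadraticTwist_iff (hd : d ≠ 0) (x₀ : ℚ_[3]) :
    IsUniqueStableLineThree (W.quadraticTwist d) ((d : ℚ_[3]) * x₀) ↔ IsUniqueStableLineThree W x₀ := by
  have hd' : (d : ℚ_[3]) ≠ 0 := by exact_mod_cast hd
  unfold IsUniqueStableLineThree
  constructor
  · rintro ⟨h0, huniq⟩
    refine ⟨(isRoot_Ψ₃_quadraticTwist_iff W hd x₀).mp h0, fun r hr ↦ ?_⟩
    exact mul_left_cancel₀ hd' (huniq _ ((isRoot_Ψ₃_quadraticTwist_iff W hd r).mpr hr))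
  · rintro ⟨h0, huniq⟩
    refine ⟨(isRoot_Ψ₃_quadraticTwist_iff W hd x₀).mpr h0, fun r hr ↦ ?_⟩
    have hr' : ((W.baseChange ℚ_[3]).Ψ₃).IsRoot ((d : ℚ_[3])⁻¹ * r) := by
      rw [← isRoot_Ψ₃_quadraticTwist_iff W hd, ← mul_assoc, mul_inv_cancel₀ hd', one_mul]; exact hr
    rw [← huniq _ hr', ← mul_assoc, mul_inv_cancel₀ hd', one_mul]

/-- **The twist multiplies the sign by `d³`**: `F^{W^d}(dx₀) = d³ · F^W(x₀)` — the line character is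
multiplied by the quadratic character of `ℚ₃(√d)`. [cite: Serre1972, §1.11] -/
theorem stableLineSignThree_quadraticTwist (x₀ : ℚ_[3]) :
    stableLineSignThree (W.quadraticTwist d) ((d : ℚ_[3]) * x₀) = (d : ℚ_[3]) ^ 3 * stableLineSignThree W x₀ :=
  eval_Ψ₂Sq_baseChange_quadraticTwist W d x₀

end Twist

/-! ## §3 The `χ₋₃`-twist: ORD1 ↔ ET1, ORDM ↔ ETM, IRR and SPLIT fixed -/

section NegThree

variable (W : WeierstrassCurve ℚ)

/-- One-line shapes under the `−3` twist: `F ↦ (−3)³F = 3²·(−3F)` — parity of `v₃` flips and the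
unit part changes sign. [cite: Serre1972, §1.11] -/
theorem oneLine_twist_negThree_iff (P Q : ℤ → Prop) (ε : ℚ_[3])
    (hPQ : ∀ v : ℤ, P (1 + v) ↔ Q v) (hP2 : ∀ v c : ℤ, P (2 * c + v) ↔ P v) :
    (∃ x₀, IsUniqueStableLineThree (W.quadraticTwist (-3)) x₀ ∧
        stableLineSignThree (W.quadraticTwist (-3)) x₀ ≠ 0 ∧
        P (stableLineSignThree (W.quadraticTwist (-3)) x₀).valuation ∧
        UnitPartCongThree (stableLineSignThree (W.quadraticTwist (-3)) x₀) ε) ↔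
      (∃ x₀, IsUniqueStableLineThree W x₀ ∧ stableLineSignThree W x₀ ≠ 0 ∧
        Q (stableLineSignThree W x₀).valuation ∧ UnitPartCongThree (stableLineSignThree W x₀) (-ε)) := by
  have hd : (-3 : ℚ) ≠ 0 := by norm_num
  have hd' : ((-3 : ℚ) : ℚ_[3]) ≠ 0 := by exact_mod_cast hd
  have h3 : (3 : ℚ_[3]) ≠ 0 := by norm_num
  -- `F^{W^{-3}}(-3 x₀) = 3² · (−3 · F^W(x₀))`
  have hsign : ∀ x₀, stableLineSignThree (W.quadraticTwist (-3)) (((-3 : ℚ) : ℚ_[3]) * x₀) =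
      (3 : ℚ_[3]) ^ 2 * (-3 * stableLineSignThree W x₀) := fun x₀ ↦ by
    rw [stableLineSignThree_quadraticTwist]; push_cast; ring
  constructor
  · rintro ⟨y₀, hy, hs, hv, hε⟩
    set x₀ := ((-3 : ℚ) : ℚ_[3])⁻¹ * y₀ with hx₀
    have hyx : ((-3 : ℚ) : ℚ_[3]) * x₀ = y₀ := by rw [hx₀, ← mul_assoc, mul_inv_cancel₀ hd', one_mul]
    rw [← hyx] at hy hs hv hε
    have hx := (isUniqueStableLineThree_quadraticTwist_iff W hd x₀).mp hy
    have hsW : stableLineSignThree W x₀ ≠ 0 := by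
      intro h0; apply hs; rw [hsign, h0, mul_zero, mul_zero]
    have hs3 : -3 * stableLineSignThree W x₀ ≠ 0 := mul_ne_zero (by norm_num) hsW
    obtain ⟨hval, hunit⟩ := sq_mul_shape_invariant h3 hs3
    obtain ⟨hval3, hunit3⟩ := neg_three_mul_shape hsW ε
    rw [hsign] at hv hε
    refine ⟨x₀, hx, hsW, ?_, ?_⟩
    · rw [hval, hval3] at hv
      exact (hPQ _).mp ((hP2 _ _).mp hv)
    · exact hunit3.mp ((hunit ε).mp hε)
  · rintro ⟨x₀, hx, hs, hv, hε⟩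
    have hs3 : -3 * stableLineSignThree W x₀ ≠ 0 := mul_ne_zero (by norm_num) hs
    obtain ⟨hval, hunit⟩ := sq_mul_shape_invariant h3 hs3
    obtain ⟨hval3, hunit3⟩ := neg_three_mul_shape hs ε
    refine ⟨((-3 : ℚ) : ℚ_[3]) * x₀, (isUniqueStableLineThree_quadraticTwist_iff W hd x₀).mpr hx,
      ?_, ?_, ?_⟩
    · rw [hsign]; exact mul_ne_zero (pow_ne_zero 2 h3) hs3
    · rw [hsign, hval, hval3]
      exact (hP2 _ _).mpr ((hPQ _).mpr hv)
    · rw [hsign, hunit ε]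
      exact hunit3.mpr hε

/-- **ORD1 ↔ ET1 under the `χ₋₃`-twist.** [cite: Serre1972, §1.11] -/
theorem shapeORD1Three_twist_iff_shapeET1Three :
    ShapeORD1Three (W.quadraticTwist (-3)) ↔ ShapeET1Three W := by
  have h := oneLine_twist_negThree_iff W Odd Even (-1)
    (fun v ↦ ⟨fun ⟨k, hk⟩ ↦ ⟨k, by omega⟩, fun ⟨k, hk⟩ ↦ ⟨k, by omega⟩⟩)
    (fun v c ↦ ⟨fun ⟨k, hk⟩ ↦ ⟨k - c, by omega⟩, fun ⟨k, hk⟩ ↦ ⟨k + c, by omega⟩⟩)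
  rw [neg_neg] at h
  exact h

/-- **ORDM ↔ ETM under the `χ₋₃`-twist.** [cite: Serre1972, §1.11] -/
theorem shapeORDMThree_twist_iff_shapeETMThree :
    ShapeORDMThree (W.quadraticTwist (-3)) ↔ ShapeETMThree W :=
  oneLine_twist_negThree_iff W Odd Even 1
    (fun v ↦ ⟨fun ⟨k, hk⟩ ↦ ⟨k, by omega⟩, fun ⟨k, hk⟩ ↦ ⟨k, by omega⟩⟩)
    (fun v c ↦ ⟨fun ⟨k, hk⟩ ↦ ⟨k - c, by omega⟩, fun ⟨k, hk⟩ ↦ ⟨k + c, by omega⟩⟩)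

/-- **ET1 ↔ ORD1 under the `χ₋₃`-twist.** [cite: Serre1972, §1.11] -/
theorem shapeET1Three_twist_iff_shapeORD1Three :
    ShapeET1Three (W.quadraticTwist (-3)) ↔ ShapeORD1Three W := by
  have h := oneLine_twist_negThree_iff W Even Odd 1
    (fun v ↦ ⟨fun ⟨k, hk⟩ ↦ ⟨k - 1, by omega⟩, fun ⟨k, hk⟩ ↦ ⟨k + 1, by omega⟩⟩)
    (fun v c ↦ ⟨fun ⟨k, hk⟩ ↦ ⟨k - c, by omega⟩, fun ⟨k, hk⟩ ↦ ⟨k + c, by omega⟩⟩)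
  exact h

/-- **ETM ↔ ORDM under the `χ₋₃`-twist.** [cite: Serre1972, §1.11] -/
theorem shapeETMThree_twist_iff_shapeORDMThree :
    ShapeETMThree (W.quadraticTwist (-3)) ↔ ShapeORDMThree W := by
  have h := oneLine_twist_negThree_iff W Even Odd (-1)
    (fun v ↦ ⟨fun ⟨k, hk⟩ ↦ ⟨k - 1, by omega⟩, fun ⟨k, hk⟩ ↦ ⟨k + 1, by omega⟩⟩)
    (fun v c ↦ ⟨fun ⟨k, hk⟩ ↦ ⟨k - c, by omega⟩, fun ⟨k, hk⟩ ↦ ⟨k + c, by omega⟩⟩)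
  rw [neg_neg] at h
  exact h

/-- **IRR is twist-invariant.** [cite: Cremona1997, §3.8 (l = 3)] -/
theorem shapeIrrThree_twist_iff : ShapeIrrThree (W.quadraticTwist (-3)) ↔ ShapeIrrThree W := by
  have hd : (-3 : ℚ) ≠ 0 := by norm_num
  have hd' : ((-3 : ℚ) : ℚ_[3]) ≠ 0 := by exact_mod_cast hd
  constructor
  · intro h x hx
    exact h _ ((isRoot_Ψ₃_quadraticTwist_iff W hd x).mpr hx)
  · intro h y hy
    apply h (((-3 : ℚ) : ℚ_[3])⁻¹ * y)
    rw [← isRoot_Ψ₃_quadraticTwist_iff W hd, ← mul_assoc, mul_inv_cancel₀ hd', one_mul]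
    exact hy

/-- **SPLIT is twist-invariant.** [cite: Cremona1997, §3.8 (l = 3)] -/
theorem shapeSplitThree_twist_iff : ShapeSplitThree (W.quadraticTwist (-3)) ↔ ShapeSplitThree W := by
  have hd : (-3 : ℚ) ≠ 0 := by norm_num
  have hd' : ((-3 : ℚ) : ℚ_[3]) ≠ 0 := by exact_mod_cast hd
  constructor
  · rintro ⟨a, b, hab, ha, hb⟩
    refine ⟨((-3 : ℚ) : ℚ_[3])⁻¹ * a, ((-3 : ℚ) : ℚ_[3])⁻¹ * b, fun h ↦ hab ?_, ?_, ?_⟩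
    · have := congrArg (fun z ↦ ((-3 : ℚ) : ℚ_[3]) * z) h
      simpa only [← mul_assoc, mul_inv_cancel₀ hd', one_mul] using this
    · rw [← isRoot_Ψ₃_quadraticTwist_iff W hd, ← mul_assoc, mul_inv_cancel₀ hd', one_mul]; exact ha
    · rw [← isRoot_Ψ₃_quadraticTwist_iff W hd, ← mul_assoc, mul_inv_cancel₀ hd', one_mul]; exact hb
  · rintro ⟨a, b, hab, ha, hb⟩
    exact ⟨_, _, fun h ↦ hab (mul_left_cancel₀ hd' h), (isRoot_Ψ₃_quadraticTwist_iff W hd a).mpr ha,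
      (isRoot_Ψ₃_quadraticTwist_iff W hd b).mpr hb⟩

/-- **ORD-side ↔ ET-side under the `χ₋₃`-twist** (the census's "the −3 twist swaps ORD ↔ ET").
[cite: Serre1972, §1.11] -/
theorem shapeOrdSideThree_twist_iff_shapeEtSideThree :
    ShapeOrdSideThree (W.quadraticTwist (-3)) ↔ ShapeEtSideThree W :=
  or_congr (shapeORD1Three_twist_iff_shapeET1Three W) (shapeORDMThree_twist_iff_shapeETMThree W)

end NegThree

end Summit.BirchSwinnertonDyer.BirchSwinnertonDyer.Theorems.CompanionShape

end
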